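import Summits.Ventures.YMGap.Thresholds.SharpPoincare
import HarnessLib

/-!
# Robust ball (Y2) — CONCENTRATION PASSES TO EVERY INFINITE-VOLUME LIMIT STATE

HONEST FRAMING: venture file of the cell `pub-ymgap` (QuantumFields programme), track ROBUST-BALL, seat rb-p2 (g13); the limit-passage companion of
`HeatBathConcentration` (exponential concentration from a heat-bath Poincaré inequality, uniformly in the volume).  Abstract over the torus bound: IF on every
torus `(ℤ/L)^d`, `L ≥ 2`, every bounded measurable `f` with per-link oscillations `δ_ℓ` satisfies `μ_{β,L}{f − E f ≥ r} ≤ B(r/‖δ‖₂)` for a continuous `B`, THEN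
every tight (subsequential) infinite-volume limit `μ` of the torus Wilson states satisfies, for every continuous cylinder observable `F` with link oscillations
`|F(U) − F(U[e ↦ g])| ≤ δ_e` (`e` in the support `Λ`), `μ{F − E_μ F ≥ r} ≤ B(r/‖δ‖_{ℓ²(Λ)})` (★★★
`measureReal_deviation_ge_le_of_mem_infiniteVolumeLimitPoints_of_torus`).  Proof: a continuous piecewise-linear cutoff `ψ_η` between the indicators of
`{t ≥ E_μF + r}` and `{t ≥ E_μF + r − η}` is a bounded continuous cylinder observable, so `∫ ψ_η(F) dμ` is the limit of the torus expectations; on the torus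
`Λ_L` (large `L`: the support embeds injectively, `eventually_injOn_torusEdge`, and `|E_L F − E_μ F| < η`) the observable `F ∘ torusLift` has the same `ℓ²`
oscillation norm, so the torus bound applies with `r − 2η`; let `η → 0`.  With the `SU(2)`, `d = 4`, `0 ≤ β_W < 2/9` torus cell of `HeatBathSweepCells`
(`B(x) = e^{2/3} e^{−x (2 − 9β_W)^{1/2}/√2}`) this gives exponential concentration of every such cylinder observable in EVERY infinite-volume limit state,
hypothesis-free on the window (that cell is gated on the farm lane; this file is the abstract step).  LATTICE statements; nothing about `β → ∞`, the continuum or Clay.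
0 sorry, 0 definitions.  References: M. Ledoux, The Concentration of Measure Phenomenon (AMS 2001) §3.1; E. Seiler, LNP 159 (1982) Ch. 2 (torus limits).
Everything here is proved. [folklore]
-/

noncomputable section

open scoped Topology
open MeasureTheory Filter Function Real Finset ProbabilityTheory
open Literature.MathematicalPhysics.QuantumFieldTheory
open Literature.MathematicalPhysics.QuantumLattice (fundamentalRep continuous_fundamentalRep torusEdge torusLift toTorusObservable
  infiniteVolumeLimitPoints IsInfiniteVolumeLimitAlong IsCylinder LGConfig)

namespace Summit.Ventures.YMGap.RobustBall.HeatBathConcentration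

variable {d N : ℕ}

/-- ★★★ **A VOLUME-UNIFORM DEVIATION BOUND ON THE TORI PASSES TO EVERY INFINITE-VOLUME LIMIT STATE**: if on every torus `(ℤ/L)^d`, `L ≥ 2`, every bounded
measurable `f` with per-link oscillations `|f(U) − f(U[ℓ ↦ g])| ≤ δ_ℓ` (`∑ δ_ℓ² > 0`) satisfies `μ_{β,L}{f − E f ≥ r} ≤ B(r / ‖δ‖₂)` for all `r`, with `B`
continuous, then for every tight limit `μ` of the torus Wilson states at coupling `β`, every continuous cylinder observable `F` supported in `Λ` with
`|F(U) − F(U[e ↦ g])| ≤ δ_e` (`e ∈ Λ`, `∑_{e∈Λ} δ_e² > 0`) and every `r`, `μ{F − E_μ F ≥ r} ≤ B(r / (∑_{e∈Λ} δ_e²)^{1/2})`. [folklore] -/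
theorem measureReal_deviation_ge_le_of_mem_infiniteVolumeLimitPoints_of_torus {β : ℝ} {B : ℝ → ℝ} (hB : Continuous B)
    (htorus : ∀ (L : ℕ) [NeZero L], 1 < L → ∀ (f : GaugeConfig d L (Matrix.specialUnitaryGroup (Fin N) ℂ) → ℝ), Measurable f →
      (∃ M : ℝ, ∀ U, |f U| ≤ M) → ∀ (δ : Edge d L → ℝ), (∀ ℓ U g, |f U - f (update U ℓ g)| ≤ δ ℓ) → 0 < ∑ ℓ, δ ℓ ^ 2 → ∀ r : ℝ,
      (wilsonMeasure (d := d) (L := L) (fundamentalRep (Fin N)) β).real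
          {U | r ≤ f U - ∫ U', f U' ∂(wilsonMeasure (d := d) (L := L) (fundamentalRep (Fin N)) β)} ≤ B (r / Real.sqrt (∑ ℓ, δ ℓ ^ 2)))
    {μ : Measure (LGConfig d (Matrix.specialUnitaryGroup (Fin N) ℂ))}
    (hμ : μ ∈ infiniteVolumeLimitPoints (d := d) (fundamentalRep (Fin N)) β)
    (Λ : Finset (ZdEdge d)) {F : LGConfig d (Matrix.specialUnitaryGroup (Fin N) ℂ) → ℝ} (hFcyl : IsCylinder F Λ) (hFc : Continuous F)
    (δ : ZdEdge d → ℝ) (hδ : ∀ e ∈ Λ, ∀ U g, |F U - F (update U e g)| ≤ δ e) (hD : 0 < ∑ e ∈ Λ, δ e ^ 2) (r : ℝ) :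
    μ.real {U | r ≤ F U - ∫ U', F U' ∂μ} ≤ B (r / Real.sqrt (∑ e ∈ Λ, δ e ^ 2)) := by
  classical
  obtain ⟨Ls, hLs, hprob, hlim⟩ := hμ
  haveI := hprob
  haveI : SecondCountableTopology (Matrix (Fin N) (Fin N) ℂ) := inferInstanceAs (SecondCountableTopology (Fin N → Fin N → ℂ))
  haveI : SecondCountableTopology (Matrix.specialUnitaryGroup (Fin N) ℂ) := Topology.IsEmbedding.subtypeVal.secondCountableTopology
  have hρc := continuous_fundamentalRep (Fin N)
  set s : ℝ := Real.sqrt (∑ e ∈ Λ, δ e ^ 2) with hs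
  set c : ℝ := ∫ U', F U' ∂μ with hc
  -- `F` is bounded
  obtain ⟨C, hC⟩ : ∃ C, ∀ U, |F U| ≤ C := by
    obtain ⟨C, hC⟩ := (isCompact_univ (X := LGConfig d (Matrix.specialUnitaryGroup (Fin N) ℂ))).exists_bound_of_continuousOn hFc.continuousOn
    exact ⟨C, fun U => by simpa [Real.norm_eq_abs] using hC U (Set.mem_univ _)⟩
  -- the torus expectations of `F` converge to `c`; the support embeds injectively in large tori
  have hck : Tendsto (fun k => wilsonExpectation (L := Ls k + 1) (fundamentalRep (Fin N)) β (toTorusObservable (Ls k + 1) F)) atTop (𝓝 c) :=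
    hlim F Λ hFcyl hFc ⟨C, hC⟩
  have hinj : ∀ᶠ k : ℕ in atTop, Set.InjOn (torusEdge (d := d) (Ls k + 1)) ↑Λ := by
    have h1 := Summit.Ventures.YMGap.LatticeBakryEmery.eventually_injOn_torusEdge (d := d) Λ
    have h2 : Tendsto (fun k => Ls k + 1) atTop atTop := tendsto_atTop_mono (fun k => Nat.le_succ (Ls k)) hLs.tendsto_atTop
    exact h2.eventually h1
  have hbig : ∀ᶠ k : ℕ in atTop, 1 < Ls k + 1 := by
    refine (eventually_ge_atTop 1).mono fun k hk => ?_
    have h := hLs.id_le k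
    dsimp at h
    omega
  -- Step A: for every `η > 0`, `μ{F − c ≥ r} ≤ B((r − 2η)/s)`
  have hA : ∀ η : ℝ, 0 < η → μ.real {U | r ≤ F U - c} ≤ B ((r - 2 * η) / s) := by
    intro η hη
    -- the cutoff
    set ψ : ℝ → ℝ := fun t => max 0 (min 1 ((t - c - r) / η + 1)) with hψ
    have hψc : Continuous ψ :=
      continuous_const.max (continuous_const.min ((((continuous_id.sub continuous_const).sub continuous_const).div_const η).add
        continuous_const))
    have hψ0 : ∀ t, 0 ≤ ψ t := fun t => le_max_left _ _
    have hψ1 : ∀ t, ψ t ≤ 1 := fun t => max_le zero_le_one (min_le_left _ _)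
    have hψ_one : ∀ t, c + r ≤ t → ψ t = 1 := fun t ht => by
      have h1 : 1 ≤ (t - c - r) / η + 1 := by
        have : 0 ≤ (t - c - r) / η := div_nonneg (by linarith) hη.le
        linarith
      simp only [hψ, min_eq_left h1]
      exact max_eq_right zero_le_one
    have hψ_zero : ∀ t, t < c + r - η → ψ t = 0 := fun t ht => by
      have h1 : (t - c - r) / η + 1 < 0 := by
        rw [div_add_one hη.ne', div_neg_iff]
        right; constructor <;> linarith
      simp only [hψ]
      exact max_eq_left ((min_le_right _ _).trans h1.le)
    -- (1) `μ{F − c ≥ r} ≤ ∫ ψ(F) dμ`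
    have hψFm : Measurable fun U => ψ (F U) := (hψc.comp hFc).measurable
    have hψFi : Integrable (fun U => ψ (F U)) μ :=
      Integrable.of_bound hψFm.aestronglyMeasurable 1 (ae_of_all _ fun U => by
        rw [Real.norm_eq_abs, abs_of_nonneg (hψ0 _)]; exact hψ1 _)
    have hSm : MeasurableSet {U | r ≤ F U - c} := measurableSet_le measurable_const (hFc.measurable.sub measurable_const)
    have h1 : μ.real {U | r ≤ F U - c} ≤ ∫ U, ψ (F U) ∂μ := by
      rw [← integral_indicator_one hSm]
      refine integral_mono ((integrable_const _).indicator hSm) hψFi fun U => ?_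
      by_cases hU : U ∈ {U | r ≤ F U - c}
      · have hU' : c + r ≤ F U := by simp only [Set.mem_setOf_eq] at hU; linarith
        rw [Set.indicator_of_mem hU, Pi.one_apply, hψ_one (F U) hU']
      · rw [Set.indicator_of_notMem hU]; exact hψ0 _
    -- (2) `∫ ψ(F) dμ` is the limit of the torus expectations
    have h2 : Tendsto (fun k => wilsonExpectation (L := Ls k + 1) (fundamentalRep (Fin N)) β
        (toTorusObservable (Ls k + 1) fun U => ψ (F U))) atTop (𝓝 (∫ U, ψ (F U) ∂μ)) :=
      hlim (fun U => ψ (F U)) Λ (fun U V hUV => by show ψ (F U) = ψ (F V); rw [hFcyl hUV]) (hψc.comp hFc)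
        ⟨1, fun U => by rw [abs_of_nonneg (hψ0 _)]; exact hψ1 _⟩
    -- (3) the torus expectations are eventually `≤ B((r − 2η)/s)`
    have hclose : ∀ᶠ k : ℕ in atTop, dist (wilsonExpectation (L := Ls k + 1) (fundamentalRep (Fin N)) β (toTorusObservable (Ls k + 1) F)) c < η :=
      Metric.tendsto_nhds.1 hck η hη
    have h3 : ∀ᶠ k : ℕ in atTop, wilsonExpectation (L := Ls k + 1) (fundamentalRep (Fin N)) β
        (toTorusObservable (Ls k + 1) fun U => ψ (F U)) ≤ B ((r - 2 * η) / s) := by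
      filter_upwards [hclose, hinj, hbig] with k hk hinjk hbigk
      set L' : ℕ := Ls k + 1 with hL'
      haveI := isProbabilityMeasure_wilsonMeasure (d := d) (L := L') (fundamentalRep (Fin N)) hρc β
      set μk : Measure (GaugeConfig d L' (Matrix.specialUnitaryGroup (Fin N) ℂ)) := wilsonMeasure (d := d) (L := L') (fundamentalRep (Fin N)) β with hμk
      set Fk : GaugeConfig d L' (Matrix.specialUnitaryGroup (Fin N) ℂ) → ℝ := toTorusObservable L' F with hFk
      have hFk_apply : ∀ U, Fk U = F (torusLift L' U) := fun U => rfl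
      have hliftc : Continuous (torusLift (d := d) (G := Matrix.specialUnitaryGroup (Fin N) ℂ) L') :=
        continuous_pi fun e => continuous_apply _
      have hFkc : Continuous Fk := hFc.comp hliftc
      have hFkm : Measurable Fk := hFkc.measurable
      have hFkb : ∀ U, |Fk U| ≤ C := fun U => hC _
      set ck : ℝ := ∫ U, Fk U ∂μk with hck'
      have hckc : |ck - c| < η := by
        have : dist (wilsonExpectation (L := L') (fundamentalRep (Fin N)) β Fk) c < η := hk
        rwa [Real.dist_eq] at this
      -- per-torus-link oscillations of `Fk`
      set δk : Edge d L' → ℝ := fun ℓ => ∑ e ∈ Λ, if torusEdge L' e = ℓ then δ e else 0 with hδk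
      have hδk_osc : ∀ ℓ U g, |Fk U - Fk (update U ℓ g)| ≤ δk ℓ := by
        intro ℓ U g
        by_cases hex : ∃ e₀ ∈ Λ, torusEdge L' e₀ = ℓ
        · obtain ⟨e₀, he₀Λ, he₀⟩ := hex
          have huniq : ∀ e ∈ Λ, e ≠ e₀ → torusEdge L' e ≠ ℓ := fun e he hne hEq => hne (hinjk he he₀Λ (hEq.trans he₀.symm))
          have hδkℓ : δk ℓ = δ e₀ := by
            simp only [hδk]
            rw [Finset.sum_eq_single e₀]
            · rw [if_pos he₀]
            · intro e he hne; rw [if_neg (huniq e he hne)]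
            · intro h; exact absurd he₀Λ h
          -- the two lifted configurations agree on `Λ` with `torusLift U` and its update at `e₀`
          have hagree : F (torusLift L' (update U ℓ g)) = F (update (torusLift L' U) e₀ g) := by
            refine hFcyl fun e he => ?_
            by_cases hee : e = e₀
            · subst hee
              simp [torusLift, he₀]
            · have hne : torusEdge L' e ≠ ℓ := huniq e he hee
              simp [torusLift, hne, hee]
          rw [hδkℓ, hFk_apply, hFk_apply, hagree]
          exact hδ e₀ he₀Λ _ _
        · push Not at hex
          have hagree : F (torusLift L' (update U ℓ g)) = F (torusLift L' U) := by
            refine hFcyl fun e he => ?_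
            have hne : torusEdge L' e ≠ ℓ := hex e he
            simp [torusLift, hne]
          have hδkℓ : 0 ≤ δk ℓ := by
            simp only [hδk]
            exact Finset.sum_nonneg fun e he => by rw [if_neg (hex e he)]
          rw [hFk_apply, hFk_apply, hagree, sub_self, abs_zero]
          exact hδkℓ
      have hsumk : ∑ ℓ, δk ℓ ^ 2 = ∑ e ∈ Λ, δ e ^ 2 := by
        have hsq : ∀ ℓ, δk ℓ ^ 2 = ∑ e ∈ Λ, if torusEdge L' e = ℓ then δ e ^ 2 else 0 := by
          intro ℓ
          by_cases hex : ∃ e₀ ∈ Λ, torusEdge L' e₀ = ℓ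
          · obtain ⟨e₀, he₀Λ, he₀⟩ := hex
            have huniq : ∀ e ∈ Λ, e ≠ e₀ → torusEdge L' e ≠ ℓ := fun e he hne hEq => hne (hinjk he he₀Λ (hEq.trans he₀.symm))
            simp only [hδk]
            rw [Finset.sum_eq_single e₀, Finset.sum_eq_single e₀, if_pos he₀, if_pos he₀]
            · intro e he hne; rw [if_neg (huniq e he hne)]
            · intro h; exact absurd he₀Λ h
            · intro e he hne; rw [if_neg (huniq e he hne)]
            · intro h; exact absurd he₀Λ h
          · push Not at hex
            simp only [hδk]
            rw [Finset.sum_eq_zero fun e he => if_neg (hex e he), Finset.sum_eq_zero fun e he => if_neg (hex e he)]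
            ring
        simp_rw [hsq]
        rw [Finset.sum_comm]
        refine Finset.sum_congr rfl fun e _ => ?_
        rw [Finset.sum_ite_eq Finset.univ (torusEdge L' e) (fun _ => δ e ^ 2)]
        simp
      have hDk : 0 < ∑ ℓ, δk ℓ ^ 2 := by rw [hsumk]; exact hD
      -- the torus bound
      have hT := htorus L' hbigk Fk hFkm ⟨C, hFkb⟩ δk hδk_osc hDk (r - 2 * η)
      rw [hsumk] at hT
      -- `E_k ψ(F_k) ≤ μ_k{F_k ≥ c + r − η} ≤ μ_k{F_k − c_k ≥ r − 2η}`
      have hSk : MeasurableSet {U | c + r - η ≤ Fk U} := measurableSet_le measurable_const hFkm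
      have i1 : wilsonExpectation (L := L') (fundamentalRep (Fin N)) β (toTorusObservable L' fun U => ψ (F U)) ≤ μk.real {U | c + r - η ≤ Fk U} := by
        show ∫ U, ψ (Fk U) ∂μk ≤ μk.real {U | c + r - η ≤ Fk U}
        rw [← integral_indicator_one hSk]
        have hψi : Integrable (fun U => ψ (Fk U)) μk :=
          Integrable.of_bound (hψc.comp hFkc).measurable.aestronglyMeasurable 1 (ae_of_all _ fun U => by
            rw [Real.norm_eq_abs, abs_of_nonneg (hψ0 _)]; exact hψ1 _)
        refine integral_mono hψi ((integrable_const _).indicator hSk) fun U => ?_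
        by_cases hU : U ∈ {U | c + r - η ≤ Fk U}
        · rw [Set.indicator_of_mem hU, Pi.one_apply]; exact hψ1 _
        · have hU' : Fk U < c + r - η := by simp only [Set.mem_setOf_eq, not_le] at hU; linarith
          rw [Set.indicator_of_notMem hU, hψ_zero (Fk U) hU']
      have i2 : μk.real {U | c + r - η ≤ Fk U} ≤ μk.real {U | r - 2 * η ≤ Fk U - ∫ U', Fk U' ∂μk} := by
        refine measureReal_mono (fun U hU => ?_) (measure_ne_top _ _)
        simp only [Set.mem_setOf_eq] at hU ⊢
        have := (abs_lt.1 hckc).2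
        rw [← hck']
        linarith
      exact i1.trans (i2.trans hT)
    -- (4) conclude Step A
    exact h1.trans (le_of_tendsto h2 h3)
  -- Step B: `η → 0`
  have hlimB : Tendsto (fun n : ℕ => B ((r - 2 * (1 / ((n : ℝ) + 1))) / s)) atTop (𝓝 (B (r / s))) := by
    have h0 : Tendsto (fun n : ℕ => (1 : ℝ) / ((n : ℝ) + 1)) atTop (𝓝 0) := tendsto_one_div_add_atTop_nhds_zero_nat
    have h1 : Tendsto (fun n : ℕ => (r - 2 * (1 / ((n : ℝ) + 1))) / s) atTop (𝓝 ((r - 2 * 0) / s)) :=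
      (tendsto_const_nhds.sub (h0.const_mul 2)).div_const s
    rw [mul_zero, sub_zero] at h1
    exact (hB.tendsto _).comp h1
  exact ge_of_tendsto' hlimB fun n => hA _ (by positivity)

end Summit.Ventures.YMGap.RobustBall.HeatBathConcentration

end
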